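import Literature.NumberTheory.EllipticCurves.TunnellFormsAutomorphy
import Literature.NumberTheory.EllipticCurves.TunnellThetaAutomorphyProofs
import Literature.NumberTheory.EllipticCurves.HalfIntegralWeightFormsProofs
import HarnessLib

/-!
# Translation by `1/8` preserves `S_{k/2}(128, χ)` when `χ` is periodic modulo `16`

Infrastructure for the Cohen–Oesterlé input of Tunnell's Theorem 2
(`S_{3/2}(128, χ₂) = span {g θ₁, g θ₄, g θ₁₆}`, Tunnell 1983, p. 327): the operator
`f ↦ f(z + 1/8)` on Shimura's spaces `M_{k/2}(128, χ)`, `S_{k/2}(128, χ)` of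
`HalfIntegralWeightForms`. The matrix `τ = (1 1/8; 0 1)` normalises `Γ₀(128)`:
for `γ = (a b; c d) ∈ Γ₀(128)`, `τγτ⁻¹ = (a + c/8, b - (a-d)/8 - c/64; c, d - c/8)` is integral
(`8 ∣ a - d` since `ad ≡ 1 (mod 8)` and `a² ≡ 1 (mod 8)`) and again in `Γ₀(128)`
(`tauConj`, `tauConj_mem_Gamma0`), with `τγτ⁻¹ (z + 1/8) = γz + 1/8` (`tauConj_smul_vadd`). The
automorphy factor `j(γ, z) = ε_d⁻¹ (c/d) √(cz + d)` is compatible: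
**`j(τγτ⁻¹, z + 1/8) = j(γ, z)`** (`thetaFactor_tauConj`). We prove this from theta functions
rather than from the arithmetic of `(c/d)`: by `θ(w + 1/8) = ζ₈ θ(w) - (1 + ζ₈) θ(4w) + 2 θ(16w)`
(`thetaMul_one_vadd_eighth`, splitting `n² mod 8`) and the common transformation law of
`θ, θ(4·), θ(16·)` under `γ` with `64 ∣ c` (`thetaMul_smul`), `θ(γz + 1/8) = j(γ, z) θ(z + 1/8)`
(`thetaMul_one_vadd_eighth_smul`); comparing with `θ(τγτ⁻¹ w) = j(τγτ⁻¹, w) θ(w)` at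
`w = z + 1/8` gives the claim (the two factors differ a priori by a constant, which is `1`
because `θ(· + 1/8) ≢ 0`). Consequently, for a character `χ` modulo `128` that is periodic
modulo `16` (`χ(d + 16e) = χ(d)`), **`f ∈ M_{k/2}(128, χ)` implies `f(· + 1/8) ∈ M_{k/2}(128, χ)`,
and likewise for `S_{k/2}(128, χ)`** (`vadd_eighth_mem_halfIntModularForms`,
`vadd_eighth_mem_halfIntCuspForms`); the cusp conditions are transported along
`z ↦ (8z + 1)/8` by `isBoundedAtImInfty_slashSq_comp` / `isZeroAtImInfty_slashSq_comp`
(`HalfIntegralWeightFormsProofs`). Iterating, `f(· + j/8)` lies in the space for every `j : ℕ`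
(`vadd_eighth_mul_mem_halfIntCuspForms`).

No statement of the tree is used unproved; no new named facts.

## References

* G. Shimura, *On modular forms of half integral weight*, Ann. of Math. 97 (1973) 440–481, §1.
  [Shimura1973HalfIntegral]
* J. B. Tunnell, *A classical Diophantine problem and modular forms of weight 3/2*, Invent. Math.
  72 (1983) 323–334, p. 327 (the bases of `S_{3/2}(128, ·)`). [Tunnell1983Congruent]
-/

noncomputable section

open UpperHalfPlane hiding I
open Complex Filter Topology ModularGroup Matrix.SpecialLinearGroup CongruenceSubgroup
open scoped MatrixGroups Real NumberTheorySymbols Manifold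

namespace Literature.NumberTheory.EllipticCurves.Tunnell1983

open Literature.NumberTheory.EllipticCurves.ModularForms

/-! ### Translations of `ℍ` -/

/-- The translation `z ↦ x + z` of `ℍ` is the action of `(1 x; 0 1) ∈ GL(2, ℝ)⁺`. [folklore] -/
theorem exists_smul_eq_vadd (x : ℝ) :
    ∃ g : GL (Fin 2) ℝ, 0 < g.det.val ∧ ∀ z : ℍ, g • z = x +ᵥ z := by
  let g : GL (Fin 2) ℝ := Matrix.GeneralLinearGroup.mkOfDetNeZero !![1, x; 0, 1]
    (by rw [Matrix.det_fin_two_of]; norm_num)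
  have hval : (g : Matrix (Fin 2) (Fin 2) ℝ) = !![1, x; 0, 1] := rfl
  have hdet : 0 < g.det.val := by
    rw [Matrix.GeneralLinearGroup.val_det_apply, hval, Matrix.det_fin_two_of]; norm_num
  refine ⟨g, hdet, fun z ↦ ?_⟩
  apply UpperHalfPlane.ext
  rw [UpperHalfPlane.coe_smul_of_det_pos hdet, coe_vadd, num, denom, hval]
  simp
  ring

/-- The translation `z ↦ x + z` of `ℍ` is holomorphic. [folklore] -/
theorem mdifferentiable_vadd (x : ℝ) : MDiff (fun z : ℍ ↦ x +ᵥ z) := by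
  obtain ⟨g, hdet, hg⟩ := exists_smul_eq_vadd x
  have : (fun z : ℍ ↦ x +ᵥ z) = fun z : ℍ ↦ g • z := funext fun z ↦ (hg z).symm
  rw [this]
  exact UpperHalfPlane.mdifferentiable_smul hdet

/-- Holomorphic functions compose with translations. [folklore] -/
theorem mdifferentiable_comp_vadd {F : ℍ → ℂ} (hF : MDiff F) (x : ℝ) :
    MDiff (fun z : ℍ ↦ F (x +ᵥ z)) :=
  hF.comp (mdifferentiable_vadd x)

/-! ### `θ(w + 1/8) = ζ₈ θ(w) - (1 + ζ₈) θ(4w) + 2 θ(16w)` -/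

/-- `ζ₈ = e^{2πi/8}`. [folklore] -/
def zeta8 : ℂ := cexp (2 * Real.pi * I / 8)

/-- `ζ₈⁸ = 1`. [folklore] -/
theorem zeta8_pow_eight : zeta8 ^ 8 = 1 := by
  rw [zeta8, ← Complex.exp_nat_mul]
  have : ((8 : ℕ) : ℂ) * (2 * Real.pi * I / 8) = 2 * Real.pi * I := by push_cast; ring
  rw [this, Complex.exp_two_pi_mul_I]

/-- `ζ₈ ≠ 0`. [folklore] -/
theorem zeta8_ne_zero : zeta8 ≠ 0 := Complex.exp_ne_zero _

/-- The terms of `θ₁` at `w + 1/8`: `e^{2πi k²(w + 1/8)} = e^{2πi k²/8} e^{2πi k² w}`. [folklore] -/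
theorem thetaTerm_one_vadd_eighth (w : ℍ) (k : ℤ) :
    thetaTerm 1 ((8⁻¹ : ℝ) +ᵥ w) k = cexp (2 * Real.pi * I * (k : ℂ) ^ 2 / 8) * thetaTerm 1 w k := by
  rw [thetaTerm, thetaTerm, coe_vadd, ← Complex.exp_add]
  congr 1
  push_cast
  ring

/-- `e^{2πi (4m)²/8} = 1`. [folklore] -/
theorem cexp_sq_four_mul (m : ℤ) : cexp (2 * Real.pi * I * (((4 * m : ℤ) : ℂ)) ^ 2 / 8) = 1 := by
  rw [← Complex.exp_zero]
  exact cexp_eq_cexp_of_sub_eq (2 * m ^ 2) (by push_cast; ring)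

/-- `e^{2πi (4m+2)²/8} = -1`. [folklore] -/
theorem cexp_sq_four_mul_add_two (m : ℤ) :
    cexp (2 * Real.pi * I * (((4 * m + 2 : ℤ) : ℂ)) ^ 2 / 8) = -1 := by
  rw [show (-1 : ℂ) = cexp (Real.pi * I) by rw [Complex.exp_pi_mul_I]]
  exact cexp_eq_cexp_of_sub_eq (2 * m ^ 2 + 2 * m) (by push_cast; ring)

/-- `e^{2πi (2m+1)²/8} = ζ₈` (`(2m+1)² = 8 · m(m+1)/2 + 1`). [folklore] -/
theorem cexp_sq_two_mul_add_one (m : ℤ) :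
    cexp (2 * Real.pi * I * (((2 * m + 1 : ℤ) : ℂ)) ^ 2 / 8) = zeta8 := by
  obtain ⟨u, hu⟩ := Int.even_mul_succ_self m
  rw [zeta8]
  refine cexp_eq_cexp_of_sub_eq u ?_
  have hu' : ((m : ℂ)) * (m + 1) = u + u := by exact_mod_cast hu
  push_cast
  linear_combination (Real.pi * I) * hu'

/-- `e^{2πi (2j)²·4 z}`-type reindexing: the even-indexed terms of `θ₄` are the terms of `θ₁₆`.
[folklore] -/
theorem thetaTerm_four_two_mul (z : ℍ) (j : ℤ) : thetaTerm 4 z (2 * j) = thetaTerm 16 z j := by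
  unfold thetaTerm
  congr 1
  push_cast
  ring

/-- `θ₄ = θ₁₆ + ∑_j e^{2πi 4(2j+1)² z}` (even and odd indices). [folklore] -/
theorem thetaMul_four_eq (z : ℍ) :
    thetaMul 4 z = thetaMul 16 z + ∑' j : ℤ, thetaTerm 4 z (2 * j + 1) := by
  have hi21 : Function.Injective (fun k : ℤ ↦ 2 * k + 1) :=
    (add_left_injective 1).comp (mul_right_injective₀ two_ne_zero)
  have h4 := hasSum_thetaTerm 4 (by norm_num) z
  have he : HasSum (fun j : ℤ ↦ thetaTerm 4 z (2 * j)) (thetaMul 16 z) :=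
    (hasSum_thetaTerm 16 (by norm_num) z).congr_fun fun j ↦ thetaTerm_four_two_mul z j
  have ho : HasSum (fun j : ℤ ↦ thetaTerm 4 z (2 * j + 1)) (∑' j : ℤ, thetaTerm 4 z (2 * j + 1)) :=
    (h4.summable.comp_injective hi21).hasSum
  exact h4.unique (hasSum_int_even_add_odd he ho)

/-- **`θ(w + 1/8) = ζ₈ θ(w) - (1 + ζ₈) θ(4w) + 2 θ(16w)`**: split `θ(w + 1/8) = ∑ e^{2πik²/8} e^{2πik²w}`
according to `k mod 4` — `e^{2πik²/8}` is `1`, `ζ₈`, `-1`, `ζ₈` for `k ≡ 0, 1, 2, 3 (mod 4)` — and use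
`∑_{k odd} = θ₁ - θ₄`, `∑_{4 ∣ k} = θ₁₆`, `∑_{k ≡ 2 (4)} = θ₄ - θ₁₆`. [folklore] -/
theorem thetaMul_one_vadd_eighth (w : ℍ) :
    thetaMul 1 ((8⁻¹ : ℝ) +ᵥ w) =
      zeta8 * thetaMul 1 w - (1 + zeta8) * thetaMul 4 w + 2 * thetaMul 16 w := by
  have hi21 : Function.Injective (fun k : ℤ ↦ 2 * k + 1) :=
    (add_left_injective 1).comp (mul_right_injective₀ two_ne_zero)
  have h := hasSum_thetaTerm 1 one_pos ((8⁻¹ : ℝ) +ᵥ w)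
  -- odd part
  set O₁ := ∑' j : ℤ, thetaTerm 1 w (2 * j + 1) with hO₁
  have hO₁' : O₁ = thetaMul 1 w - thetaMul 4 w := by
    rw [thetaMul_one_eq w]; ring
  have ho1 : HasSum (fun j : ℤ ↦ thetaTerm 1 w (2 * j + 1)) O₁ :=
    ((hasSum_thetaTerm 1 one_pos w).summable.comp_injective hi21).hasSum
  have ho : HasSum (fun j : ℤ ↦ thetaTerm 1 ((8⁻¹ : ℝ) +ᵥ w) (2 * j + 1)) (zeta8 * O₁) := by
    refine (ho1.mul_left zeta8).congr_fun fun j ↦ ?_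
    rw [thetaTerm_one_vadd_eighth, cexp_sq_two_mul_add_one]
  -- even part, split again
  set O₄ := ∑' j : ℤ, thetaTerm 4 w (2 * j + 1) with hO₄
  have hO₄' : O₄ = thetaMul 4 w - thetaMul 16 w := by
    rw [thetaMul_four_eq w]; ring
  have ho4 : HasSum (fun j : ℤ ↦ thetaTerm 4 w (2 * j + 1)) O₄ :=
    ((hasSum_thetaTerm 4 (by norm_num) w).summable.comp_injective hi21).hasSum
  have hee : HasSum (fun m : ℤ ↦ thetaTerm 1 ((8⁻¹ : ℝ) +ᵥ w) (2 * (2 * m))) (thetaMul 16 w) := by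
    refine (hasSum_thetaTerm 16 (by norm_num) w).congr_fun fun m ↦ ?_
    rw [thetaTerm_one_vadd_eighth, show (2 * (2 * m) : ℤ) = 4 * m by ring, cexp_sq_four_mul,
      one_mul, show (4 * m : ℤ) = 2 * (2 * m) by ring, thetaTerm_one_two_mul,
      thetaTerm_four_two_mul]
  have heo : HasSum (fun m : ℤ ↦ thetaTerm 1 ((8⁻¹ : ℝ) +ᵥ w) (2 * (2 * m + 1))) (-O₄) := by
    refine (ho4.neg).congr_fun fun m ↦ ?_
    rw [thetaTerm_one_vadd_eighth, show (2 * (2 * m + 1) : ℤ) = 4 * m + 2 by ring,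
      cexp_sq_four_mul_add_two, show (4 * m + 2 : ℤ) = 2 * (2 * m + 1) by ring,
      thetaTerm_one_two_mul]
    ring
  have he : HasSum (fun j : ℤ ↦ thetaTerm 1 ((8⁻¹ : ℝ) +ᵥ w) (2 * j)) (thetaMul 16 w + -O₄) :=
    hasSum_int_even_add_odd (f := fun j : ℤ ↦ thetaTerm 1 ((8⁻¹ : ℝ) +ᵥ w) (2 * j)) hee heo
  have htot := hasSum_int_even_add_odd he ho
  rw [h.unique htot, hO₁', hO₄']
  ring

/-! ### `θ, θ₄, θ₁₆` transform alike under `γ` with `64 ∣ c` -/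

/-- For `γ = (a b; c d)` with `64 ∣ c`: `θ_s(γz) = j(γ, z) θ_s(z)` for `s = 1, 4, 16` (the symbols
`(1/d) = (4/d) = (16/d) = 1`). [cite: Tunnell1983Congruent, p. 326] -/
theorem thetaMul_smul_eq_thetaFactor_mul {s : ℕ} (hs : s = 1 ∨ s = 4 ∨ s = 16) {γ : SL(2, ℤ)}
    (h64 : (64 : ℤ) ∣ γ 1 0) (z : ℍ) :
    thetaMul s (γ • z) = thetaFactor (γ 1 0) (γ 1 1) z * thetaMul s z := by
  have hodd : Odd (γ 1 1 : ℤ) :=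
    odd_d_of_even_c (even_iff_two_dvd.mpr ((show (2 : ℤ) ∣ 64 by norm_num).trans h64))
  have hn : Odd (γ 1 1 : ℤ).natAbs := Int.natAbs_odd.mpr hodd
  rcases hs with rfl | rfl | rfl
  · rw [thetaMul_smul one_pos ((show (4 * (1 : ℕ) : ℤ) ∣ 64 by norm_num).trans h64) z,
      Nat.cast_one, jacobiSym.one_left, Int.cast_one, one_mul]
  · rw [thetaMul_smul (by norm_num) ((show (4 * (4 : ℕ) : ℤ) ∣ 64 by norm_num).trans h64) z,
      show ((4 : ℕ) : ℤ) = 4 ^ 1 * 1 by norm_num, jacobiSym_four_pow_mul hn, jacobiSym.one_left,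
      Int.cast_one, one_mul]
  · rw [thetaMul_smul (by norm_num) ((show (4 * (16 : ℕ) : ℤ) ∣ 64 by norm_num).trans h64) z,
      show ((16 : ℕ) : ℤ) = 16 by norm_num, jacobiSym_sixteen hn, Int.cast_one, one_mul]

/-- **`θ(γz + 1/8) = j(γ, z) θ(z + 1/8)`** for `γ ∈ SL₂(ℤ)` with `64 ∣ c` (any sign of `c`).
[folklore] -/
theorem thetaMul_one_vadd_eighth_smul {γ : SL(2, ℤ)} (h64 : (64 : ℤ) ∣ γ 1 0) (z : ℍ) :
    thetaMul 1 ((8⁻¹ : ℝ) +ᵥ (γ • z)) =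
      thetaFactor (γ 1 0) (γ 1 1) z * thetaMul 1 ((8⁻¹ : ℝ) +ᵥ z) := by
  rw [thetaMul_one_vadd_eighth, thetaMul_one_vadd_eighth,
    thetaMul_smul_eq_thetaFactor_mul (Or.inl rfl) h64,
    thetaMul_smul_eq_thetaFactor_mul (Or.inr (Or.inl rfl)) h64,
    thetaMul_smul_eq_thetaFactor_mul (Or.inr (Or.inr rfl)) h64]
  ring

/-- `θ(· + 1/8)` does not vanish identically: at `z₀ = i - 1/8` it is `θ(i) ≠ 0`. [folklore] -/
theorem thetaMul_one_vadd_eighth_ne_zero :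
    thetaMul 1 ((8⁻¹ : ℝ) +ᵥ ((-8⁻¹ : ℝ) +ᵥ UpperHalfPlane.I)) ≠ 0 := by
  rw [vadd_vadd, show (8⁻¹ : ℝ) + -8⁻¹ = 0 by ring, zero_vadd, thetaMul_one_eq_shimuraTheta]
  exact shimuraTheta_I_ne_zero

/-! ### The conjugate `τγτ⁻¹`, `τ = (1 1/8; 0 1)` -/

section TauConj

variable {γ : SL(2, ℤ)}

/-- `8 ∣ a - d` for `(a b; c d) ∈ SL₂(ℤ)` with `8 ∣ c`: `a(a - d) = a² - 1 - bc` and `a² ≡ 1 (mod 8)`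
for odd `a`. [folklore] -/
theorem eight_dvd_a_sub_d (h8 : (8 : ℤ) ∣ γ 1 0) : (8 : ℤ) ∣ γ 0 0 - γ 1 1 := by
  have hdet := det_eq_one' γ
  obtain ⟨e, he⟩ := h8
  have hodd : Odd (γ 0 0 : ℤ) := by
    have : Odd ((γ 0 0 : ℤ) * γ 1 1) := by
      rw [show (γ 0 0 : ℤ) * γ 1 1 = 2 * (4 * e * γ 0 1) + 1 by
        rw [he] at hdet; linear_combination hdet]
      exact odd_two_mul_add_one _
    exact (Int.odd_mul.mp this).1
  obtain ⟨m, hm⟩ := hodd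
  obtain ⟨u, hu⟩ := Int.even_mul_succ_self m
  -- `a (a - d) = a² - ad = a² - 1 - bc`, `a² - 1 = 4 m (m + 1) = 8u`
  have h1 : (8 : ℤ) ∣ γ 0 0 * (γ 0 0 - γ 1 1) := by
    refine ⟨u - γ 0 1 * e, ?_⟩
    have : (γ 0 0 : ℤ) * (γ 0 0 - γ 1 1) = (γ 0 0) ^ 2 - 1 - γ 0 1 * γ 1 0 := by
      linear_combination (-1 : ℤ) * hdet
    rw [this, he, hm]
    linear_combination 4 * hu
  have hcop : IsCoprime (8 : ℤ) (γ 0 0) := by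
    rw [hm, show (8 : ℤ) = 2 ^ 3 by norm_num]
    exact IsCoprime.pow_left ⟨-m, 1, by ring⟩
  exact hcop.dvd_of_dvd_mul_left h1

/-- **`τγτ⁻¹` for `τ = (1 1/8; 0 1)` and `128 ∣ c`**: the integral matrix
`(a + c/8, b - (a-d)/8 - c/64; c, d - c/8)` of determinant `1`. [folklore] -/
def tauConj (γ : SL(2, ℤ)) (h128 : (128 : ℤ) ∣ γ 1 0) : SL(2, ℤ) :=
  ⟨!![γ 0 0 + γ 1 0 / 8, γ 0 1 - (γ 0 0 - γ 1 1) / 8 - γ 1 0 / 64; γ 1 0, γ 1 1 - γ 1 0 / 8], by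
    have hdet := det_eq_one' γ
    obtain ⟨e, he⟩ := h128
    obtain ⟨u, hu⟩ := eight_dvd_a_sub_d ((show (8 : ℤ) ∣ 128 by norm_num).trans ⟨e, he⟩)
    have e8 : (γ 1 0 : ℤ) / 8 = 16 * e := by rw [he]; omega
    have e64 : (γ 1 0 : ℤ) / 64 = 2 * e := by rw [he]; omega
    have eu : ((γ 0 0 : ℤ) - γ 1 1) / 8 = u := by rw [hu]; omega
    rw [Matrix.det_fin_two_of, e8, e64, eu]
    linear_combination hdet - 16 * e * hu + (u + 2 * e) * he⟩

variable (h128 : (128 : ℤ) ∣ γ 1 0)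

/-- Lower-left entry of `τγτ⁻¹`: `c`. [folklore] -/
theorem tauConj_apply_10 : (tauConj γ h128 1 0 : ℤ) = γ 1 0 := rfl

/-- Lower-right entry of `τγτ⁻¹`: `d - c/8`. [folklore] -/
theorem tauConj_apply_11 : (tauConj γ h128 1 1 : ℤ) = γ 1 1 - γ 1 0 / 8 := rfl

/-- Upper-left entry of `τγτ⁻¹`: `a + c/8`. [folklore] -/
theorem tauConj_apply_00 : (tauConj γ h128 0 0 : ℤ) = γ 0 0 + γ 1 0 / 8 := rfl

/-- Upper-right entry of `τγτ⁻¹`: `b - (a-d)/8 - c/64`. [folklore] -/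
theorem tauConj_apply_01 : (tauConj γ h128 0 1 : ℤ) = γ 0 1 - (γ 0 0 - γ 1 1) / 8 - γ 1 0 / 64 := rfl

/-- `τγτ⁻¹ ∈ Γ₀(128)` (same lower-left entry). [folklore] -/
theorem tauConj_mem_Gamma0 : tauConj γ h128 ∈ Gamma0 128 := by
  rw [Gamma0_mem, tauConj_apply_10]
  obtain ⟨e, he⟩ := h128
  rw [he]
  push_cast
  rw [show (128 : ZMod 128) = 0 from rfl, zero_mul]

/-- `d(τγτ⁻¹) = d - 16(c/128)`: the new `d` differs from `d` by a multiple of `16`. [folklore] -/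
theorem tauConj_apply_11_eq : ∃ e : ℤ, γ 1 0 = 128 * e ∧ (tauConj γ h128 1 1 : ℤ) = γ 1 1 - 16 * e := by
  obtain ⟨e, he⟩ := h128
  refine ⟨e, he, ?_⟩
  rw [tauConj_apply_11, he]
  omega

/-- **`τγτ⁻¹ (z + 1/8) = γz + 1/8`.** [folklore] -/
theorem tauConj_smul_vadd (z : ℍ) :
    tauConj γ h128 • ((8⁻¹ : ℝ) +ᵥ z) = (8⁻¹ : ℝ) +ᵥ (γ • z) := by
  obtain ⟨e, he⟩ := h128
  obtain ⟨u, hu⟩ := eight_dvd_a_sub_d ((show (8 : ℤ) ∣ 128 by norm_num).trans ⟨e, he⟩)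
  have e8 : (γ 1 0 : ℤ) / 8 = 16 * e := by rw [he]; omega
  have e64 : (γ 1 0 : ℤ) / 64 = 2 * e := by rw [he]; omega
  have eu : ((γ 0 0 : ℤ) - γ 1 1) / 8 = u := by rw [hu]; omega
  apply UpperHalfPlane.ext
  rw [coe_smul_eq', coe_vadd, coe_vadd, coe_smul_eq', tauConj_apply_00, tauConj_apply_01,
    tauConj_apply_10, tauConj_apply_11, e8, e64, eu,
    show (((8⁻¹ : ℝ)) : ℂ) = (8 : ℂ)⁻¹ by norm_num]
  have hden : ((γ 1 0 : ℤ) : ℂ) * z + ((γ 1 1 : ℤ) : ℂ) ≠ 0 := sl_denom_ne_zero γ z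
  have hec : ((γ 1 0 : ℤ) : ℂ) = 128 * (e : ℂ) := by exact_mod_cast he
  have huc : ((γ 0 0 : ℤ) : ℂ) - ((γ 1 1 : ℤ) : ℂ) = 8 * (u : ℂ) := by exact_mod_cast hu
  push_cast
  have hden_eq : ((γ 1 0 : ℤ) : ℂ) * ((8 : ℂ)⁻¹ + z) + (((γ 1 1 : ℤ) : ℂ) - 16 * e) =
      ((γ 1 0 : ℤ) : ℂ) * z + ((γ 1 1 : ℤ) : ℂ) := by
    linear_combination (8 : ℂ)⁻¹ * hec
  have hnum : (((γ 0 0 : ℤ) : ℂ) + 16 * e) * ((8 : ℂ)⁻¹ + z) + (((γ 0 1 : ℤ) : ℂ) - u - 2 * e) =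
      (((γ 1 0 : ℤ) : ℂ) * z + ((γ 1 1 : ℤ) : ℂ)) / 8 + (((γ 0 0 : ℤ) : ℂ) * z + ((γ 0 1 : ℤ) : ℂ)) := by
    linear_combination (1 / 8 : ℂ) * huc + (-(z : ℂ) / 8) * hec
  rw [hden_eq, hnum]
  field_simp

end TauConj

/-! ### Compatibility of the automorphy factor with the translation -/

/-- The square-root arguments agree: `c (z + 1/8) + (d - c/8) = c z + d`. [folklore] -/
theorem linear_vadd_eighth {c d : ℤ} (h8 : (8 : ℤ) ∣ c) (z : ℍ) :
    (c : ℂ) * (((8⁻¹ : ℝ) +ᵥ z : ℍ) : ℂ) + ((d - c / 8 : ℤ) : ℂ) = (c : ℂ) * z + d := by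
  obtain ⟨e, rfl⟩ := h8
  rw [coe_vadd, show ((8 : ℤ) * e) / 8 = e by omega]
  push_cast
  ring

/-- `j(τγτ⁻¹, z + 1/8)` is a constant multiple of `j(γ, z)`: both are multiples of `√(cz + d)`.
[folklore] -/
theorem thetaFactor_tauConj_eq_const_mul {γ : SL(2, ℤ)} (h128 : (128 : ℤ) ∣ γ 1 0) (z : ℍ) :
    thetaFactor (tauConj γ h128 1 0) (tauConj γ h128 1 1) ((8⁻¹ : ℝ) +ᵥ z) =
      ((thetaEps (γ 1 1 - γ 1 0 / 8))⁻¹ * (shimuraSymbol (γ 1 0) (γ 1 1 - γ 1 0 / 8) : ℂ) *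
        ((thetaEps (γ 1 1))⁻¹ * (shimuraSymbol (γ 1 0) (γ 1 1) : ℂ))⁻¹) *
      thetaFactor (γ 1 0) (γ 1 1) z := by
  have h8 : (8 : ℤ) ∣ γ 1 0 := (show (8 : ℤ) ∣ 128 by norm_num).trans h128
  rw [tauConj_apply_10, tauConj_apply_11, thetaFactor, thetaFactor, linear_vadd_eighth h8 z]
  have hε : thetaEps (γ 1 1) ≠ 0 := thetaEps_ne_zero _
  have hε' : thetaEps (γ 1 1 - γ 1 0 / 8) ≠ 0 := thetaEps_ne_zero _
  have hs : (shimuraSymbol (γ 1 0) (γ 1 1) : ℂ) ≠ 0 := by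
    have h1 := shimuraSymbol_sq (gcd_c_d_eq_one γ)
    have : shimuraSymbol (γ 1 0) (γ 1 1) ≠ 0 := fun h0 ↦ by rw [h0] at h1; norm_num at h1
    exact_mod_cast this
  field_simp

/-- **`j(τγτ⁻¹, z + 1/8) = j(γ, z)`** for `γ ∈ Γ₀(128)`: compare `θ(τγτ⁻¹ w) = j(τγτ⁻¹, w) θ(w)` at
`w = z + 1/8` with `θ(γz + 1/8) = j(γ, z) θ(z + 1/8)`; the constant of
`thetaFactor_tauConj_eq_const_mul` is then `1`, because `θ(· + 1/8) ≢ 0` and `j ≠ 0`.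
[cite: Shimura1973HalfIntegral, §1] -/
theorem thetaFactor_tauConj {γ : SL(2, ℤ)} (h128 : (128 : ℤ) ∣ γ 1 0) (z : ℍ) :
    thetaFactor (tauConj γ h128 1 0) (tauConj γ h128 1 1) ((8⁻¹ : ℝ) +ᵥ z) =
      thetaFactor (γ 1 0) (γ 1 1) z := by
  set κ : ℂ := (thetaEps (γ 1 1 - γ 1 0 / 8))⁻¹ * (shimuraSymbol (γ 1 0) (γ 1 1 - γ 1 0 / 8) : ℂ) *
        ((thetaEps (γ 1 1))⁻¹ * (shimuraSymbol (γ 1 0) (γ 1 1) : ℂ))⁻¹ with hκ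
  have h64 : (64 : ℤ) ∣ γ 1 0 := (show (64 : ℤ) ∣ 128 by norm_num).trans h128
  -- the theta identity at every point
  have key : ∀ w : ℍ, κ * thetaFactor (γ 1 0) (γ 1 1) w * thetaMul 1 ((8⁻¹ : ℝ) +ᵥ w) =
      thetaFactor (γ 1 0) (γ 1 1) w * thetaMul 1 ((8⁻¹ : ℝ) +ᵥ w) := by
    intro w
    have h1 := shimuraTheta_smul_eq_thetaFactor (by norm_num : 4 ∣ 128) (tauConj_mem_Gamma0 h128)
      ((8⁻¹ : ℝ) +ᵥ w)
    rw [tauConj_smul_vadd, ← thetaMul_one_eq_shimuraTheta, ← thetaMul_one_eq_shimuraTheta,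
      thetaMul_one_vadd_eighth_smul h64, thetaFactor_tauConj_eq_const_mul h128 w] at h1
    exact h1.symm
  -- evaluate at `z₀ = i - 1/8`
  set z₀ : ℍ := (-8⁻¹ : ℝ) +ᵥ UpperHalfPlane.I with hz₀
  have hne : thetaFactor (γ 1 0) (γ 1 1) z₀ * thetaMul 1 ((8⁻¹ : ℝ) +ᵥ z₀) ≠ 0 :=
    mul_ne_zero (thetaFactor_ne_zero (gcd_c_d_eq_one γ) z₀) thetaMul_one_vadd_eighth_ne_zero
  have hκ1 : κ = 1 := by
    have := key z₀
    rw [mul_assoc] at this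
    exact (mul_eq_right₀ hne).mp this
  rw [thetaFactor_tauConj_eq_const_mul h128 z, ← hκ, hκ1, one_mul]

/-- **`χ(d') j(τγτ⁻¹, z + 1/8)^k = χ(d) j(γ, z)^k`**: the automorphy factor of weight `k/2`,
level `128` and character `χ` is translation-compatible when `χ` is periodic modulo `16`.
[folklore] -/
theorem autFactor_tauConj {k : ℕ} {χ : DirichletCharacter ℂ 128}
    (hχ : ∀ d e : ℤ, χ (((d - 16 * e : ℤ)) : ZMod 128) = χ ((d : ℤ) : ZMod 128))
    {γ : SL(2, ℤ)} (h128 : (128 : ℤ) ∣ γ 1 0) (z : ℍ) :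
    autFactor k 128 χ (tauConj γ h128) ((8⁻¹ : ℝ) +ᵥ z) = autFactor k 128 χ γ z := by
  unfold autFactor
  rw [thetaFactor_tauConj h128 z]
  obtain ⟨e, _, h11⟩ := tauConj_apply_11_eq h128
  rw [h11, hχ]

/-! ### Translation by `1/8` preserves `M_{k/2}(128, χ)` and `S_{k/2}(128, χ)` -/

variable {k : ℕ} {χ : DirichletCharacter ℂ 128}

/-- Membership in `Γ₀(128)` gives `128 ∣ c`. [folklore] -/
theorem dvd_of_mem_Gamma0 {γ : SL(2, ℤ)} (hγ : γ ∈ Gamma0 128) : (128 : ℤ) ∣ γ 1 0 := by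
  rw [Gamma0_mem] at hγ
  exact (ZMod.intCast_zmod_eq_zero_iff_dvd _ 128).mp hγ

/-- **`f(· + 1/8)` is again automorphic**: `f(γz + 1/8) = χ(d) j(γ, z)^k f(z + 1/8)` for
`γ ∈ Γ₀(128)`, from the automorphy of `f` at `τγτ⁻¹`. [folklore] -/
theorem apply_vadd_eighth_smul (hχ : ∀ d e : ℤ, χ (((d - 16 * e : ℤ)) : ZMod 128) = χ ((d : ℤ) : ZMod 128))
    {f : ℍ → ℂ} (hf : f ∈ halfIntModularForms k 128 χ) {γ : SL(2, ℤ)} (hγ : γ ∈ Gamma0 128)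
    (z : ℍ) :
    f ((8⁻¹ : ℝ) +ᵥ (γ • z)) = autFactor k 128 χ γ z * f ((8⁻¹ : ℝ) +ᵥ z) := by
  have h128 := dvd_of_mem_Gamma0 hγ
  rw [← tauConj_smul_vadd h128, apply_smul_eq_of_mem (by norm_num) hf (tauConj_mem_Gamma0 h128),
    autFactor_tauConj hχ h128]

/-- The translate as a composite with `z ↦ (8z + 1)/8`. [folklore] -/
theorem coe_vadd_eighth_eq (z : ℍ) :
    (((8⁻¹ : ℝ) +ᵥ z : ℍ) : ℂ) = (((8 : ℤ) : ℂ) * z + ((1 : ℤ) : ℂ)) / ((8 : ℤ) : ℂ) := by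
  rw [coe_vadd]
  push_cast
  ring

/-- **Translation by `1/8` preserves `M_{k/2}(128, χ)`** (`χ` periodic modulo `16`).
[cite: Shimura1973HalfIntegral, §1] -/
theorem vadd_eighth_mem_halfIntModularForms
    (hχ : ∀ d e : ℤ, χ (((d - 16 * e : ℤ)) : ZMod 128) = χ ((d : ℤ) : ZMod 128))
    {f : ℍ → ℂ} (hf : f ∈ halfIntModularForms k 128 χ) :
    (fun z : ℍ ↦ f ((8⁻¹ : ℝ) +ᵥ z)) ∈ halfIntModularForms k 128 χ := by
  refine ⟨mdifferentiable_comp_vadd hf.1 _, isThetaAutomorphic_of_apply_smul_eq (by norm_num)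
    (fun γ hγ z ↦ apply_vadd_eighth_smul hχ hf hγ z), fun σ ↦ ?_⟩
  exact isBoundedAtImInfty_slashSq_comp (f := f) (φ := fun z : ℍ ↦ (8⁻¹ : ℝ) +ᵥ z) (A := 8)
    (B := 1) (D := 8) (by norm_num) (by norm_num) coe_vadd_eighth_eq hf.2.2 σ

/-- **Translation by `1/8` preserves `S_{k/2}(128, χ)`** (`χ` periodic modulo `16`).
[cite: Shimura1973HalfIntegral, §1] -/
theorem vadd_eighth_mem_halfIntCuspForms
    (hχ : ∀ d e : ℤ, χ (((d - 16 * e : ℤ)) : ZMod 128) = χ ((d : ℤ) : ZMod 128))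
    {f : ℍ → ℂ} (hf : f ∈ halfIntCuspForms k 128 χ) :
    (fun z : ℍ ↦ f ((8⁻¹ : ℝ) +ᵥ z)) ∈ halfIntCuspForms k 128 χ := by
  have hf' := halfIntCuspForms_le_halfIntModularForms k 128 χ hf
  refine ⟨mdifferentiable_comp_vadd hf.1 _, isThetaAutomorphic_of_apply_smul_eq (by norm_num)
    (fun γ hγ z ↦ apply_vadd_eighth_smul hχ hf' hγ z), fun σ ↦ ?_⟩
  exact isZeroAtImInfty_slashSq_comp (f := f) (φ := fun z : ℍ ↦ (8⁻¹ : ℝ) +ᵥ z) (A := 8)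
    (B := 1) (D := 8) (by norm_num) (by norm_num) coe_vadd_eighth_eq hf.2.2 σ

/-- Iterated translates: `f(· + j/8) ∈ S_{k/2}(128, χ)` for every `j : ℕ`. [folklore] -/
theorem vadd_eighth_mul_mem_halfIntCuspForms
    (hχ : ∀ d e : ℤ, χ (((d - 16 * e : ℤ)) : ZMod 128) = χ ((d : ℤ) : ZMod 128))
    {f : ℍ → ℂ} (hf : f ∈ halfIntCuspForms k 128 χ) (j : ℕ) :
    (fun z : ℍ ↦ f (((j : ℝ) * 8⁻¹ : ℝ) +ᵥ z)) ∈ halfIntCuspForms k 128 χ := by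
  induction j with
  | zero => simpa using hf
  | succ j ih =>
    have h := vadd_eighth_mem_halfIntCuspForms hχ ih
    have heq : (fun z : ℍ ↦ f (((j : ℝ) * 8⁻¹ : ℝ) +ᵥ ((8⁻¹ : ℝ) +ᵥ z))) =
        fun z : ℍ ↦ f ((((j + 1 : ℕ) : ℝ) * 8⁻¹ : ℝ) +ᵥ z) := by
      funext z
      rw [vadd_vadd]
      congr 2
      push_cast
      ring
    rw [← heq]
    exact h

/-- Iterated translates: `f(· + j/8) ∈ M_{k/2}(128, χ)` for every `j : ℕ`. [folklore] -/
theorem vadd_eighth_mul_mem_halfIntModularForms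
    (hχ : ∀ d e : ℤ, χ (((d - 16 * e : ℤ)) : ZMod 128) = χ ((d : ℤ) : ZMod 128))
    {f : ℍ → ℂ} (hf : f ∈ halfIntModularForms k 128 χ) (j : ℕ) :
    (fun z : ℍ ↦ f (((j : ℝ) * 8⁻¹ : ℝ) +ᵥ z)) ∈ halfIntModularForms k 128 χ := by
  induction j with
  | zero => simpa using hf
  | succ j ih =>
    have h := vadd_eighth_mem_halfIntModularForms hχ ih
    have heq : (fun z : ℍ ↦ f (((j : ℝ) * 8⁻¹ : ℝ) +ᵥ ((8⁻¹ : ℝ) +ᵥ z))) =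
        fun z : ℍ ↦ f ((((j + 1 : ℕ) : ℝ) * 8⁻¹ : ℝ) +ᵥ z) := by
      funext z
      rw [vadd_vadd]
      congr 2
      push_cast
      ring
    rw [← heq]
    exact h

/-- An even integer is not a unit modulo `128`. [folklore] -/
theorem not_isUnit_zmod_of_even {d : ℤ} (hd : Even d) : ¬ IsUnit ((d : ℤ) : ZMod 128) := by
  intro h
  rw [ZMod.coe_int_isUnit_iff_isCoprime] at h
  obtain ⟨m, rfl⟩ := hd
  obtain ⟨u, v, huv⟩ := h
  have h2 : (2 : ℤ) ∣ 1 := ⟨64 * u + v * m, by linear_combination -huv⟩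
  omega

/-- **The hypothesis on `χ` holds for Tunnell's `χ₂ = (2/·)`** (conductor `8`): `χ₂(d - 16e) = χ₂(d)`.
[folklore] -/
theorem tunnellChar_sub_sixteen_mul (d e : ℤ) :
    tunnellChar (((d - 16 * e : ℤ)) : ZMod 128) = tunnellChar ((d : ℤ) : ZMod 128) := by
  rcases Int.even_or_odd d with hd | hd
  · have hd' : Even (d - 16 * e) := hd.sub ⟨8 * e, by ring⟩
    rw [MulChar.map_nonunit _ (not_isUnit_zmod_of_even hd),
      MulChar.map_nonunit _ (not_isUnit_zmod_of_even hd')]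
  · have hd' : Odd (d - 16 * e) := by
      obtain ⟨m, rfl⟩ := hd
      exact ⟨m - 8 * e, by ring⟩
    rw [tunnellChar_apply_of_odd hd, tunnellChar_apply_of_odd hd',
      jacobiSym.at_two (Int.natAbs_odd.mpr hd), jacobiSym.at_two (Int.natAbs_odd.mpr hd'),
      χ₈_natAbs, χ₈_natAbs]
    congr 2
    push_cast
    rw [show (16 : ZMod 8) = 0 from rfl, zero_mul, sub_zero]

end Literature.NumberTheory.EllipticCurves.Tunnell1983

end
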